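import Literature.Barriers.NavierStokesRegularity.NavierStokesInequalitySingularSolutions
import Literature.Barriers.NavierStokesRegularity.NavierStokesInequalityArrangement
import Literature.Analysis.FluidPDE.NormalisedPressure
import HarnessLib

/-!
# Scheffer's singular NSI solution: the switching decomposition (Ożański 2017, §2 and §4)

Proof-architecture file for the barrier fact
`Literature.Barriers.NavierStokesRegularity.NavierStokesInequalitySingularSolution` (Scheffer 1985,
Thm. 1.1; restated as Ożański 2019, Thm. 1.5), following W. S. Ożański, *On weak solutions to
the Navier–Stokes inequality with internal singularities*, arXiv:1709.00602 — the simplified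
presentation of Scheffer's construction — whose proof of his Theorem 1 (= the barrier fact)
consists of exactly two printed statements:

* **(A) the switching argument** (§2 "Sketch of the proof of Theorem 1", pp. 6–7; Scheffer 1985,
  Lemma 2.3, pp. 55–57). IF there are `T > 0`, `ν₀ > 0`, `τ ∈ (0,1)`, `z ∈ ℝ³`, a compact
  `G ⊆ ℝ³` and a divergence-free `u ∈ C^∞(ℝ³ × (-η, T+η); ℝ³)` with `supp u(t) = G` for
  `t ∈ [0,T]`, satisfying the Navier–Stokes inequality CLASSICALLY,
  `∂ₜ|u|² ≤ -u·∇(|u|² + 2p) + 2ν u·Δu` on `ℝ³ × [0,T]` for every `ν ∈ [0, ν₀]` (his (2.1); `p(t)`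
  the pressure function of `u(t)`), such that `Γ(x) = τx + z` maps `G` into itself and `u` has
  the *interior gain of magnitude* `|u(Γ(x), T)| ≥ τ⁻¹ |u(x, 0)|` (his (2.2)), THEN the switched
  field `𝔲 := u^{(j)}` on `[t_j, t_{j+1})`, `u^{(j)}(x,t) = τ^{-j} u(Γ^{-j}x, τ^{-2j}(t - t_j))`,
  `t_j = T Σ_{k<j} τ^{2k}`, `𝔲 := 0` from `T₀ = lim t_j = T/(1-τ²)` on (his (2.3)–(2.4)), is a
  weak solution of the NSI for every `ν ∈ [0, ν₀]`, with `C^∞` slices supported in `G`, and is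
  unbounded in every neighbourhood of `(x₀, T₀)`, `{x₀} = ⋂ⱼ Γʲ(G) = {z/(1-τ)}` (pp. 6–7:
  `‖𝔲(t)‖ ≤ sup_{[0,T]} ‖u‖`, `∫₀^∞ ‖∇𝔲‖² = (Σⱼ τʲ) ∫₀ᵀ ‖∇u‖²`, the local energy inequality
  from the per-piece inequalities on `[t_j, t_{j+1}]`, the drops
  `|u^{(j)}(t_j)| ≤ |u^{(j-1)}(t_j)|` and dominated convergence as `S' → T₀`);
* **(B) the existence of such a block** (§4: a geometric arrangement `U₁, U₂, (vᵢ, fᵢ, φᵢ), T,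
  τ, z` with (4.1)–(4.2), Lemma 8, the choice (4.13) of `ν₀`, and Proposition 9, after which
  "`u` given by the proposition satisfies all the properties required in Section 2", p. 16; the
  arrangement is constructed in §5; Scheffer 1985: "Theorem 1.1 is a consequence of Lemma 6.4,
  Lemma 3.3 and Lemma 2.4", p. 84).

Both statements, and the hypothesis structure `IsNSIBlock` they share, are vendored in
`NavierStokesInequalitySwitching` (facts `NSISwitching` (A) and `NSIBlockExists` (B), with the
proved assembly `navierStokesInequalitySingularSolution_of_switching : (A) → (B) → barrier fact`),
and (B) is decomposed in `NavierStokesInequalityArrangement` into facts C (`NSIArrangementExists`,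
§5) and D (`NSIBlock_of_arrangement`, §4) with the proved `nsiBlockExists_of_arrangement`. This
file keeps the two historical names `IsNSIBlock.switching` (A) and `exists_isNSIBlock` (B) as
ALIASES of those facts (see below), adds a little proved geometry of the similarity
`Γ(x) = τx + z` on a block (its centre `x₀ = blowupPoint τ z = z/(1-τ)` lies in `G`,
`center_mem`, via `Γʲ(x) - x₀ = τʲ(x - x₀)`), and records the proved route
`C → D → exists_isNSIBlock` (`exists_isNSIBlock_of_arrangement`).

## History of this file

The file originally carried a module-PRIVATE copy of the structure `IsNSIBlock` (the same twelve
fields) and stated (A), (B) as named facts over it. The private copy clashed by name with the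
public structure, so the module could import neither `NavierStokesInequalitySwitching` nor the
decomposition of (B) in `NavierStokesInequalityArrangement`, and its private constructor made
`exists_isNSIBlock` unprovable from any other module; moreover the two facts duplicated
`NSISwitching` and `NSIBlockExists` (two discharge targets for one printed statement each). The
private structure has been removed and the two facts turned into aliases:
`IsNSIBlock.switching := NSISwitching`, `exists_isNSIBlock := NSIBlockExists` — the same
statements field for field (`blowupTime T τ = T/(1-τ²)`, `blowupPoint τ z = (1-τ)⁻¹ • z`), kept
under their names for the importer `NavierStokesInequalitySingularSolutionsBridge` and for the
ledger item attached to `exists_isNSIBlock`, which is therefore discharged exactly when facts C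
and D are.

## Rendering

* Time first, `u : ℝ → ℝ³ → ℝ³`, `ℝ³ = EuclideanSpace ℝ (Fin 3)`, as in the barrier file.
* "`u ∈ C^∞(ℝ³ × [0,T]; ℝ³)` is a short-hand notation for … infinitely differentiable on
  `ℝ³ × (-η, T+η)` for some `η > 0`" (Ożański p. 6) is
  `∃ η > 0, Fluid.IsSmoothSpaceTimeOn (Ioo (-η) (T + η)) u` (accepted `ClassicalSolution`); the
  time derivative in the classical NSI is accordingly the two-sided `Fluid.timeDeriv` of `|u|²`.
* "`p` is the pressure function corresponding to `u`", `p = Σᵢⱼ ∂ᵢ∂ⱼΨ ∗ (uᵢuⱼ)`,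
  `Ψ = (4π|x|)⁻¹` (Ożański (1.1), Scheffer (1.4)) is the accepted `Literature.NS.normalisedPressure (u t)`
  (`-Δ⁻¹∂ᵢ∂ⱼ(uᵢuⱼ)`, Tao's normalised pressure, realised by the classical principal-value
  formula; for `C_c^∞` slices this is the printed convolution, Gilbarg–Trudinger Lemma 4.2, the
  tree's `NS.normalisedPressure_eq_pressurePotential`). In (A) the pressure of the weak solution
  is likewise `t ↦ NS.normalisedPressure (𝔲 t)` (Ożański's Definition 2 "incorporates the
  definition of the pressure function"), which the barrier file's `IsPressureOf` pins down anyway.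
* `u·∇q = ⟪u, ∇q⟫` with Mathlib's `gradient`, `u·Δu = ⟪u, Δu⟫` with Mathlib's Laplacian,
  `div u(t) = 0` is the accepted pointwise `Fluid.IsDivFree (u t)`, `t ∈ [0,T]`.
* The nontriviality `u(·,0) ≢ 0` — explicit in Scheffer's Lemma 2.3 ("`f₁ ≠ 0`"), tacit in
  Ożański's sketch (his block has `supp u(t) = G = R(Ū₁ ∪ Ū₂) ≠ ∅`) — is a field of the
  structure: for `u = 0`, `G = ∅` all other fields hold and the switched field has no singular
  point.
* The singular point in (A) is rendered as in the barrier file, in the essential (`L^∞`) sense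
  `¬ Fluid.IsRegularPoint 𝔲 (T₀, x₀)`; for the piecewise-classical `𝔲` this is the printed
  "unbounded in every neighbourhood" (Scheffer (1.8), (2.30): "not essentially bounded on any
  neighborhood").
* (A) concludes `∃ 𝔲` (with the printed `𝔲 = u` on `[0,T)` and `𝔲 = 0` from `T₀` on) rather
  than naming the switching formula (2.4), which belongs to its proof.

## References

* W. S. Ożański, *On weak solutions to the Navier–Stokes inequality with internal
  singularities*, arXiv:1709.00602 (2017): Thm. 1, §2 pp. 6–7 ((2.1)–(2.4)), §4 (Lemma 8,
  (4.13), Prop. 9, p. 16), §5. [`Ozanski2017NSIInternal`]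
* V. Scheffer, *A solution to the Navier–Stokes inequality with an internal singularity*,
  Comm. Math. Phys. 101 (1985), 47–85: Thm. 1.1, Lemmas 2.3–2.4 (pp. 55–57), Lemma 3.3,
  Lemma 6.4, p. 84. [`Scheffer1985`]
* W. S. Ożański, Comm. Math. Phys. 374 (2019), Thm. 1.5. [`Ozanski2019NSI`]
-/

noncomputable section

open MeasureTheory Set Function Filter Topology TopologicalSpace
open scoped ENNReal InnerProductSpace RealInnerProductSpace ContDiff Laplacian

namespace Literature.Barriers.NavierStokesRegularity

/-- Local notation for physical space `ℝ³ = EuclideanSpace ℝ (Fin 3)`. -/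
local notation "ℝ³" => EuclideanSpace ℝ (Fin 3)

/-! ### Geometry of the similarity on a classical block (`IsNSIBlock` of `NavierStokesInequalitySwitching`) -/

namespace IsNSIBlock

variable {T ν₀ τ : ℝ} {z : ℝ³} {G : Set ℝ³} {u : ℝ → ℝ³ → ℝ³}

/-- `0 < 1 - τ`. [folklore] -/
theorem one_sub_tau_pos (h : IsNSIBlock T ν₀ τ z G u) : 0 < 1 - τ :=
  sub_pos.2 h.τ_lt_one

/-- The similarity contracts towards its centre `x₀ = blowupPoint τ z = z/(1-τ)`:
`Γ(x) - x₀ = τ (x - x₀)` (the centre is its fixed point, `smul_blowupPoint_add`). [folklore] -/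
theorem similarity_sub_center (h : IsNSIBlock T ν₀ τ z G u) (x : ℝ³) :
    (τ • x + z) - blowupPoint τ z = τ • (x - blowupPoint τ z) := by
  conv_lhs => rw [← smul_blowupPoint_add h.τ_lt_one.ne z]
  rw [smul_sub]
  abel

/-- Iterating the similarity: `Γʲ(x) - x₀ = τʲ (x - x₀)`. [folklore] -/
theorem similarity_iterate_sub_center (h : IsNSIBlock T ν₀ τ z G u) (x : ℝ³) (j : ℕ) :
    (fun y : ℝ³ => τ • y + z)^[j] x - blowupPoint τ z = τ ^ j • (x - blowupPoint τ z) := by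
  induction j with
  | zero => simp
  | succ j ih =>
    rw [Function.iterate_succ_apply', h.similarity_sub_center, ih, smul_smul, pow_succ, mul_comm]

/-- **The centre `x₀ = z/(1-τ)` of the similarity lies in `G`**: it is the limit of `Γʲ(x)` for
any `x ∈ G` (`τʲ → 0`), and `Γʲ(G) ⊆ G` is closed (Ożański 2017, §2: `{x₀} = ⋂ⱼ Γʲ(G)`, the
blow-up point of the switched field). [cite: Ozanski2017NSIInternal, §2 p. 6] -/
theorem center_mem (h : IsNSIBlock T ν₀ τ z G u) : blowupPoint τ z ∈ G := by
  obtain ⟨x, hx⟩ := h.nonempty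
  set x₀ : ℝ³ := blowupPoint τ z with hx₀
  have hmem : ∀ j : ℕ, (fun y : ℝ³ => τ • y + z)^[j] x ∈ G := fun j => h.mapsTo.iterate j hx
  have hpow : Tendsto (fun j : ℕ => τ ^ j) atTop (𝓝 0) :=
    tendsto_pow_atTop_nhds_zero_of_lt_one h.τ_pos.le h.τ_lt_one
  have hlim : Tendsto (fun j : ℕ => (fun y : ℝ³ => τ • y + z)^[j] x) atTop (𝓝 x₀) := by
    have h1 : Tendsto (fun j : ℕ => τ ^ j • (x - x₀) + x₀) atTop (𝓝 ((0 : ℝ) • (x - x₀) + x₀)) :=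
      (hpow.smul_const (x - x₀)).add_const x₀
    rw [zero_smul, zero_add] at h1
    refine h1.congr fun j => ?_
    rw [← h.similarity_iterate_sub_center x j, sub_add_cancel]
  exact h.isCompact.isClosed.mem_of_tendsto hlim (Eventually.of_forall hmem)

/-- **(A) The switching argument (Ożański 2017, §2 "Sketch of the proof of Theorem 1";
Scheffer 1985, Lemma 2.3).** Given a classical NSI block `(T, ν₀, τ, z, G, u)` (`IsNSIBlock`),
the switched field `𝔲` — equal to `u^{(j)}(x,t) = τ^{-j} u(Γ^{-j}x, τ^{-2j}(t - t_j))` on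
`[t_j, t_{j+1})`, `t_j = T Σ_{k<j} τ^{2k}`, and to `0` from `T₀ = T/(1-τ²)` on — is a weak
solution of the Navier–Stokes inequality on `ℝ³ × (0,∞)` for every `ν ∈ [0, ν₀]` (with its
pressure function `t ↦ -Δ⁻¹∂ᵢ∂ⱼ(𝔲ᵢ𝔲ⱼ)(t)`), every slice `𝔲(t)`, `t ≥ 0`, is `C^∞` with support
in `G`, and `𝔲` is unbounded in every neighbourhood of `(x₀, T₀)`, `x₀ = z/(1-τ)`. ALIAS of
the named fact `NSISwitching` of `NavierStokesInequalitySwitching` (same statement), kept under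
this name for the importer `NavierStokesInequalitySingularSolutionsBridge`; nothing asserted.
[cite: Ozanski2017NSIInternal, §2 pp. 6–7 (2.3)–(2.4)] [cite: Scheffer1985, Lemma 2.3] -/
protected abbrev switching : Prop :=
  NSISwitching

end IsNSIBlock

/-- **(B) Existence of a classical NSI block with interior gain of magnitude (Ożański 2017, §4
with §5; Scheffer 1985, §§3–6).** There exist `T > 0`, `ν₀ > 0`, `τ ∈ (0,1)`, `z ∈ ℝ³`, a
compact `G ⊆ ℝ³` and `u` forming an `IsNSIBlock`: Ożański's geometric arrangement
(`U₁, U₂ ⋐ P` with structures `(vᵢ, fᵢ, φᵢ)`, `T`, `τ`, `z` satisfying (4.1)–(4.2), constructed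
in §5), `G = R(Ū₁ ∪ Ū₂)`, `ν₀` from (4.13), and the field `u` of Proposition 9 (smooth on
`ℝ³ × (-η, T+η)`, `supp u(t) = G`, `div u(t) = 0`, the classical NSI for all `ν ∈ [0, ν₀]`),
which "satisfies all the properties required in Section 2" (p. 16: the gain (2.2) from
Prop. 9 (ii) and (3.14)). ALIAS of the named fact `NSIBlockExists` of
`NavierStokesInequalitySwitching` (same statement), kept under this name for the importer and
the ledger; it follows from facts C and D of `NavierStokesInequalityArrangement`
(`exists_isNSIBlock_of_arrangement`). The heart of Scheffer's construction; nothing asserted.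
[cite: Ozanski2017NSIInternal, §4 Prop. 9 and p. 16, §5] [cite: Scheffer1985, Lemmas 2.4, 3.3, 6.4 (p. 84)] -/
abbrev exists_isNSIBlock : Prop :=
  NSIBlockExists

/-! ### (B) from the geometric arrangement (§5) and the field of §4 -/

/-- **(B) from the geometric arrangement (§5) and the field of §4.** Facts C
(`NSIArrangementExists`: Ożański 2017, §5) and D (`NSIBlock_of_arrangement`: §4, Lemma 8,
(4.13), Prop. 9 and p. 16 — "Note that `u` given by the proposition satisfies all the properties
required in Section 2") of `NavierStokesInequalityArrangement` give `exists_isNSIBlock`, by the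
accepted assembly `nsiBlockExists_of_arrangement`; hence `exists_isNSIBlock` is discharged as
soon as C and D are (Scheffer 1985, p. 84: "Theorem 1.1 is a consequence of Lemma 6.4, Lemma 3.3
and Lemma 2.4"). PROVED. [cite: Ozanski2017NSIInternal, §4 (opening paragraph) and p. 16] -/
theorem exists_isNSIBlock_of_arrangement (hC : NSIArrangementExists)
    (hD : NSIBlock_of_arrangement) : exists_isNSIBlock :=
  nsiBlockExists_of_arrangement hC hD

/-- **The barrier from the three printed ingredients A, C, D.** The switching argument (§2,
fact `NSISwitching`), the existence of a geometric arrangement (§5, fact C) and the field of §4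
(fact D) give Scheffer's theorem `NavierStokesInequalitySingularSolution` (Scheffer 1985,
Thm. 1.1; Ożański 2019, Thm. 1.5), by the accepted assemblies
`navierStokesInequalitySingularSolution_of_switching` and `nsiBlockExists_of_arrangement`.
PROVED from the three named facts. [cite: Ozanski2017NSIInternal, §2 p. 7 and §4 p. 16] -/
theorem navierStokesInequalitySingularSolution_of_arrangement (hA : NSISwitching)
    (hC : NSIArrangementExists) (hD : NSIBlock_of_arrangement) :
    NavierStokesInequalitySingularSolution :=
  navierStokesInequalitySingularSolution_of_switching hA (nsiBlockExists_of_arrangement hC hD)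

end Literature.Barriers.NavierStokesRegularity
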